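import Literature.MathematicalPhysics.QuantumFieldTheory.Balaban1983to89.B9Eq375BondGradDivTwoBackgroundSplit
import Literature.MathematicalPhysics.QuantumFieldTheory.Balaban1983to89.B9Eq326G1kSliceGradRowClosed
import Literature.MathematicalPhysics.QuantumFieldTheory.Balaban1983to89.B9Eq373BondHessianTwoBackgroundLetterTower

/-!
# `Balaban1983to89.B9Eq375BondDivergenceTwoBackgroundLetterTower` — T. Bałaban, *Propagators for lattice gauge theories in a background field*, Commun. Math. Phys. **99** (1985)
# 389–434 [Balaban1985BackgroundPropagators] (3.8) p. 392, (3.74)–(3.76) p. 405, (3.84)–(3.85) p. 407, Thm 3.3 p. 399 (*«with G′(U) replaced by G(U)»* — the divergence row), Thm 3.11 p. 416: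
# **THE DIVERGENCE SIDE OF THE `DRD*` MEMBER AT THE NE9 CHAIN: `D*_UG₁,k(1)` AND `(D*_U − D*_1)G₁,k(1)` AS LOCAL LETTERS (bond sources → site values), CONSTANTS BEFORE THE
# LATTICE** — `∃ α₀ K κ > 0` BEFORE `n, η, m, U`: on print's small-field class, for every source `f` over ONE unit block `v` with `‖f‖_∞ ≤ F` and every fine site `y`:
# `‖(D*_UG₁,k(1)f)(y)‖ ≤ K·e^{−κ d_m(Πy, v)}·F` and `‖((D*_U − D*_1)G₁,k(1)f)(y)‖ ≤ K·α·e^{−κ d_m(Πy, v)}·F` — the right-hand factors of the three-term telescoping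
# `D_UW_k(U)D*_U − D_1W_k(1)D*_1 = (D_U − D_1)W(U)D*_U + D_1(W(U) − W(1))D*_U + D_1W(1)(D*_U − D*_1)` of the smooth word (brick W-b₁ of the bond storey); from the crew's VALUE and
# SLICE-GRADIENT rows of `G₁,k` at the vacuum (`D*_1A = −Σ_μ(∇_1A)((·−e_μ,μ),μ)`, `(D*_S − D*_1)A = c•Σ_μ(S − 1)A`)

statement-level skeleton of published theorems with citation tags; proofs where landed; nothing here is a claim about the Yang–Mills mass gap

CITATION HEADER (lean-in-tree rule).  Audit cell `pub-balaban`, sub-cell `t4`, BINDER row NE9; NE9 crux-team LEAF PROVER 01 (`b2b-balaban-t4-ne9-formalise-leaf-01`, gen 100;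
bears_on: R4/N22).  Composition BY NAME: this gen's `B9Eq375BondGradDivTwoBackgroundSplit.{covDiv_flat_eq_neg_sum_covGrad, covDiv_sub_flat_apply}`; ne9-leaf-05's
`B9Eq326G1kSupRowClosed.exists_local_letter_G1k`, `B9Eq326G1kSliceGradRowClosed.exists_local_gradLetter_G1k` (at `U ≡ 1`); the OWNER's `B11Eq103H1Complex.equiv_covDivL2K`;
ne9-leaf-04's `B9Eq373TransporterLipschitzLetters`; this gen's `B9Eq373BondHessianTwoBackgroundLetterTower.{adTransportW_one_fun, inv_one_fun}` (whose instantiation boilerplate this file re-runs).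
Sources: [Balaban1985BackgroundPropagators] pp. 392, 399, 405, 407, 416 (text layer pp. 4, 11, 17, 19, 28 read by this lineage 2026-08-28).  NOTHING of print's proofs is reproduced.

WHAT IS PROVED (sorry-free; proof lane — no `def`).
* **`exists_letters_covDiv_G1k_one`** — BOTH letters of the title under one `∃ α₀ K κ` (a conjunction).
HONEST SCOPE.  Bookkeeping on the cell's MODEL rows; constants crude; «NE9 ⇐ the named binders» (O-NE9-1 #5 UNRULED); NE9 NOT PRINTED ∕ NOT PROVED; spine PROVED 0∕9; rung (B)+1 finite T⁴ — NOT
infinite volume, NOT mass gap, NOT BetaPertH, NOT Clay.  HONEST DEPENDENCY: continuum YM on T⁴ ⇐ BetaPertH ∧ nine spine estimates (0/9 proved); BetaPertH ⇐ (D1) ∧ (D4) ∧ CAP+tail; G-an2-4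
gates asym, D1 and NE2/3/4.  NEW file; nothing modified.  Net new unproved facts: 0.
-/

noncomputable section

set_option autoImplicit false

open scoped InnerProductSpace ComplexConjugate BigOperators

namespace Literature.MathematicalPhysics.QuantumFieldTheory.Balaban1983to89.B9Eq375BondDivergenceTwoBackgroundLetterTower

open B4Sect5Torus (TSite tdist tdist_nonneg tdist_triangle tdist_symm)
open B9SectCLatticeCarrier (Bond Plaq DirPair bpos btgt shift unshift shift_unshift)
open B9Eq311L2Pairing (WL2)
open B9Eq319QprimeTorus (fineP blockCoord)
open B7Prop1Explicit (U1 Wcx boxVec)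
open B11Eq103H1Complex (SiteL2K BondL2K covDerivL2K covDivL2K equiv_covDerivL2K equiv_covDivL2K)
open B9Eq310DeltaPrime (plaqHolU plaqHolU_one)
open B9Eq310HessianOperator (adTransportW)
open B9Eq315QTorus (perCfg cornerSite)
open B9Eq315QTower (towerP UlevOf)
open B9Eq315QTowerFlat (perCfg_UlevOf_one_mem_U1 norm_Wcx_UlevOf_one_sub_one_le UlevOf_one)
open B9Eq316TowerFlatIsOneStep (towerP_eq_fineP_pow siteCast)
open B9Eq326OperatorTower (laplaceAk G1k)
open B9Eq324DeltaPrimeATower (laplacePrimeAk)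
open B9Eq33CovDerivVector (covGrad covDeriv covDiv)
open B9Eq33CovDerivLocalLetterTower (tdist_bigBlock_bpos_btgt_le_one)
open B9Eq326G1kSupRowClosed (exists_local_letter_G1k)
open B9Eq326G1kSliceGradRowClosed (exists_local_gradLetter_G1k)
open B9Eq373TransporterLipschitzLetters (norm_adTransportW_sub_adTransportW_le norm_adTransportW_inv_sub_adTransportW_inv_le)
open B9Eq373BondPrincipalTwoBackgroundLetter (exp_step_le exp_two_steps_le)
open B9Eq375BondGradDivTwoBackgroundSplit (covDiv_flat_eq_neg_sum_covGrad covDiv_sub_flat_apply)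
open B9Eq373BondHessianTwoBackgroundLetterTower (adTransportW_one_fun inv_one_fun)

variable {d : ℕ} (hd : 1 ≤ d) (L : ℕ) [NeZero L] (hL : 1 ≤ L) (hL3 : 3 ≤ L)
  {𝔸 : Type*} [NormedRing 𝔸] [NormedAlgebra ℂ 𝔸] [CompleteSpace 𝔸] [NormOneClass 𝔸] [StarRing 𝔸] [NormedStarGroup 𝔸] [StarModule ℂ 𝔸]
  {W : Type*} [NormedAddCommGroup W] [InnerProductSpace ℂ W] [FiniteDimensional ℂ W] (φ : W ≃ₗ[ℂ] 𝔸)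
  {Mφ Mφ' : ℝ} (hMφ : 0 ≤ Mφ) (hMφ' : 0 ≤ Mφ') (hφ : ∀ w, ‖φ w‖ ≤ Mφ * ‖w‖) (hφ' : ∀ X, ‖φ.symm X‖ ≤ Mφ' * ‖X‖) (hstar : ∀ X : 𝔸, ‖star X‖ ≤ ‖X‖)
  {a : ℝ} (ha : 0 < a) {a' : ℝ} (ha' : 0 < a')
  (τ : 𝔸 →ₗ[ℂ] ℂ) {Cτ : ℝ} (hτ : ∀ X, ‖τ X‖ ≤ Cτ * ‖X‖) (hCτ : 0 ≤ Cτ) {Mτ : ℝ} (hτm : ∀ X Y : 𝔸, ‖τ (X * Y)‖ ≤ Mτ * ‖X‖ * ‖Y‖) (hMτ : 0 ≤ Mτ)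
  {ρw : ℝ} (hρw : 0 ≤ ρw)
  (hτ₁ : ∀ X : 𝔸, τ (star X) = conj (τ X)) (hτ₂ : ∀ X Y : 𝔸, τ (X * Y) = τ (Y * X)) (hφτ : ∀ X Y : 𝔸, ⟪φ.symm X, φ.symm Y⟫_ℂ = τ (star X * Y))

include hd hL hL3 hMφ hMφ' hφ hφ' hstar ha ha' hτ hCτ hτm hMτ hρw hτ₁ hτ₂ hφτ in
set_option maxHeartbeats 1600000 in
/-- **`D*_UG₁,k(1)` AND `(D*_U − D*_1)G₁,k(1)` AS LOCAL LETTERS AT THE NE9 CHAIN, CONSTANTS BEFORE THE LATTICE** — see the module docstring.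
[cite: Balaban1985BackgroundPropagators, (3.8) p.392, (3.74)–(3.76) p.405, (3.84)–(3.85) p.407, Thm 3.3 p.399, Thm 3.11 p.416] -/
theorem exists_letters_covDiv_G1k_one :
    ∃ α₀ K κ : ℝ, 0 < α₀ ∧ 0 ≤ K ∧ 0 < κ ∧
      ∀ (n : ℕ) (η : ℝ) (_hηL : η * (L : ℝ) ^ (n + 1) = 1) (c₀ c₁ : ℝ) [Fact (0 < c₀)] [Fact (0 < c₁)]
        (_hw : c₀ * ((L : ℝ) ^ (n + 1)) ^ d = c₁) (_hρ : |η| ^ d / c₀ ≤ ρw) (m : Fin d → ℕ) [∀ i, NeZero (m i)] (_hm : ∀ i, 1 ≤ m i)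
        (U : Bond d (towerP L m (n + 1)) → 𝔸ˣ) (α : ℝ) (_hα : 0 ≤ α) (_hαle : α ≤ α₀)
        (_hUb : ∀ b, U b ∈ U1 𝔸) (_hUη : ∀ b, ‖(U b : 𝔸) - 1‖ ≤ α * η)
        (_hUw : ∀ (x : TSite d (towerP L m (n + 1))) (μ ν : Fin d), ‖(U (shift ν x, μ) : 𝔸) - (U (x, μ) : 𝔸)‖ ≤ α * η ^ 2)
        (_hpl : ∀ p : B9SectCLatticeCarrier.Plaq d (towerP L m (n + 1)), ‖(plaqHolU U p : 𝔸) - 1‖ ≤ α * η ^ 2)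
        (hpos'₁ : ∀ x : SiteL2K ℂ d (towerP L m (n + 1)) c₀ W, x ≠ 0 →
          0 < RCLike.re ⟪x, laplacePrimeAk L m n φ η (fun _ : Bond d (towerP L m (n + 1)) => (1 : 𝔸ˣ)) a' (c₁ := c₁) x⟫_ℂ)
        (hpos₁ : ∀ x : BondL2K ℂ d (towerP L m (n + 1)) c₀ W, x ≠ 0 →
          0 < RCLike.re ⟪x, laplaceAk L m n φ η (fun _ : Bond d (towerP L m (n + 1)) => (1 : 𝔸ˣ)) hL (fun _ => 0) (fun _ => by norm_num)
            (perCfg_UlevOf_one_mem_U1 L m (n + 1)) (norm_Wcx_UlevOf_one_sub_one_le L m (n + 1) (fun _ => 0) (fun _ => le_rfl)) τ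
            (c₀ := c₀) (c₁ := c₁) a x⟫_ℂ)
        (v : TSite d m) (f : BondL2K ℂ d (towerP L m (n + 1)) c₀ W) (F : ℝ)
        (_hfv : ∀ b, blockCoord (L ^ (n + 1)) m (siteCast (towerP_eq_fineP_pow L m (n + 1)) (bpos b)) ≠ v →
          WL2.equiv ℂ (fun _ : Bond d (towerP L m (n + 1)) => c₀) W f b = 0)
        (_hfF : ∀ b, ‖WL2.equiv ℂ (fun _ : Bond d (towerP L m (n + 1)) => c₀) W f b‖ ≤ F) (y : TSite d (towerP L m (n + 1))),
        ‖WL2.equiv ℂ (fun _ : TSite d (towerP L m (n + 1)) => c₀) W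
            (covDivL2K ℂ c₀ ((η : ℂ))⁻¹ (adTransportW φ fun bd => (U bd)⁻¹)
              (G1k L m n φ η (fun _ : Bond d (towerP L m (n + 1)) => (1 : 𝔸ˣ)) hL (fun _ => 0) (fun _ => by norm_num)
                (perCfg_UlevOf_one_mem_U1 L m (n + 1)) (norm_Wcx_UlevOf_one_sub_one_le L m (n + 1) (fun _ => 0) (fun _ => le_rfl)) τ
                (c₀ := c₀) (c₁ := c₁) hpos₁ f)) y‖ ≤
          K * Real.exp (-(κ * tdist m (blockCoord (L ^ (n + 1)) m (siteCast (towerP_eq_fineP_pow L m (n + 1)) y)) v)) * F ∧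
        ‖WL2.equiv ℂ (fun _ : TSite d (towerP L m (n + 1)) => c₀) W
            (covDivL2K ℂ c₀ ((η : ℂ))⁻¹ (adTransportW φ fun bd => (U bd)⁻¹)
              (G1k L m n φ η (fun _ : Bond d (towerP L m (n + 1)) => (1 : 𝔸ˣ)) hL (fun _ => 0) (fun _ => by norm_num)
                (perCfg_UlevOf_one_mem_U1 L m (n + 1)) (norm_Wcx_UlevOf_one_sub_one_le L m (n + 1) (fun _ => 0) (fun _ => le_rfl)) τ
                (c₀ := c₀) (c₁ := c₁) hpos₁ f)) y -
          WL2.equiv ℂ (fun _ : TSite d (towerP L m (n + 1)) => c₀) W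
            (covDivL2K ℂ c₀ ((η : ℂ))⁻¹ (adTransportW φ fun bd => ((fun _ : Bond d (towerP L m (n + 1)) => (1 : 𝔸ˣ)) bd)⁻¹)
              (G1k L m n φ η (fun _ : Bond d (towerP L m (n + 1)) => (1 : 𝔸ˣ)) hL (fun _ => 0) (fun _ => by norm_num)
                (perCfg_UlevOf_one_mem_U1 L m (n + 1)) (norm_Wcx_UlevOf_one_sub_one_le L m (n + 1) (fun _ => 0) (fun _ => le_rfl)) τ
                (c₀ := c₀) (c₁ := c₁) hpos₁ f)) y‖ ≤
          K * α * Real.exp (-(κ * tdist m (blockCoord (L ^ (n + 1)) m (siteCast (towerP_eq_fineP_pow L m (n + 1)) y)) v)) * F := by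
  classical
  -- (0) the two MODEL rows of `G₁,k` (value and slice gradient), `∃`-first, and the constants
  obtain ⟨α₁, B, δ, hα₁, hB, hδ, ROW⟩ := exists_local_letter_G1k hd L hL hL3 φ hMφ hMφ' hφ hφ' hstar ha ha' (ϱ := 1 / 2) (by norm_num) (by norm_num)
    τ hτ hCτ hτm hMτ hρw hτ₁ hτ₂ hφτ 0
  obtain ⟨α₂, B', δ', hα₂, hB', hδ', GROW⟩ := exists_local_gradLetter_G1k hd L hL hL3 φ hMφ hMφ' hφ hφ' hstar ha ha' (ϱ := 1 / 2) (by norm_num) (by norm_num)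
    τ hτ hCτ hτm hMτ hρw hτ₁ hτ₂ hφτ 0
  set κ : ℝ := min δ δ' with hκdef
  have hκ0 : 0 < κ := lt_min hδ hδ'
  have hκδ : κ ≤ δ := min_le_left _ _
  have hκδ' : κ ≤ δ' := min_le_right _ _
  set Cp : ℝ := (d : ℝ) * (B' + 2 * Mφ * Mφ' * B) * Real.exp κ with hCp
  have hCp0 : 0 ≤ Cp := by positivity
  refine ⟨1, Cp, κ, one_pos, hCp0, hκ0, ?_⟩
  intro n η hηL c₀ c₁ _ _ hw hρ m _ hm U α hα hα1 hUb hUη hUw hpl hpos'₁ hpos₁ v f F hfv hfF y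
  -- (1) lattice facts
  have hLpos : (0 : ℝ) < (L : ℝ) ^ (n + 1) := pow_pos (by exact_mod_cast Nat.pos_of_ne_zero (NeZero.ne L)) _
  have hη : 0 < η := by
    by_contra h; push Not at h; nlinarith [mul_nonpos_of_nonpos_of_nonneg h hLpos.le]
  have hη1 : η ≤ 1 := by
    have hL1 : 1 ≤ L := le_trans (by norm_num) hL3
    have : (1 : ℝ) ≤ (L : ℝ) ^ (n + 1) := one_le_pow₀ (by exact_mod_cast hL1)
    nlinarith
  have hF : 0 ≤ F := (norm_nonneg _).trans (hfF (y, ⟨0, hd⟩))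
  have hc0 : 0 < c₀ := Fact.out
  -- names
  set πB : TSite d (towerP L m (n + 1)) → TSite d m := fun x => blockCoord (L ^ (n + 1)) m (siteCast (towerP_eq_fineP_pow L m (n + 1)) x) with hπB
  set g := G1k L m n φ η (fun _ : Bond d (towerP L m (n + 1)) => (1 : 𝔸ˣ)) hL (fun _ => 0) (fun _ => by norm_num) (perCfg_UlevOf_one_mem_U1 L m (n + 1))
    (norm_Wcx_UlevOf_one_sub_one_le L m (n + 1) (fun _ => 0) (fun _ => le_rfl)) τ (c₀ := c₀) (c₁ := c₁) hpos₁ f with hg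
  set A : Bond d (towerP L m (n + 1)) → W := WL2.equiv ℂ (fun _ : Bond d (towerP L m (n + 1)) => c₀) W g with hA
  -- (2) the flat class data for the rows at `(fun _ : Bond d (towerP L m (n + 1)) => (1 : 𝔸ˣ))`, `α := 0`
  have hUε1 : ∀ (j : ℕ) (bd : Bond d (towerP L m (j + 1))), ‖(UlevOf L m (n + 1) (fun _ : Bond d (towerP L m (n + 1)) => (1 : 𝔸ˣ)) j bd : 𝔸) - 1‖ ≤ (fun _ : ℕ => (0 : ℝ)) j := fun j bd => by
    rw [UlevOf_one]; simp
  have hLb1 : ∀ (j : ℕ) (bd : Bond d (towerP L m (j + 1))), UlevOf L m (n + 1) (fun _ : Bond d (towerP L m (n + 1)) => (1 : 𝔸ˣ)) j bd ∈ U1 𝔸 := fun j bd => by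
    rw [UlevOf_one]; exact one_mem _
  have hRlev1 : ∀ (j : ℕ) (bd : Bond d (towerP L m (j + 1))) (w : W), ‖adTransportW φ (UlevOf L m (n + 1) (fun _ : Bond d (towerP L m (n + 1)) => (1 : 𝔸ˣ)) j) bd w‖ ≤ ‖w‖ := fun j bd w => by
    rw [UlevOf_one, B5Eq172HodgePositivity.adTransportW_one, LinearMap.id_apply]
  have hUst1 : ∀ bd : Bond d (towerP L m (n + 1)), star ((fun _ : Bond d (towerP L m (n + 1)) => (1 : 𝔸ˣ)) bd : 𝔸) = ((((fun _ : Bond d (towerP L m (n + 1)) => (1 : 𝔸ˣ)) bd)⁻¹ : 𝔸ˣ) : 𝔸) := fun _ => by simp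
  have hUb1 : ∀ bd : Bond d (towerP L m (n + 1)), (fun _ : Bond d (towerP L m (n + 1)) => (1 : 𝔸ˣ)) bd ∈ U1 𝔸 := fun _ => one_mem _
  have hUη1 : ∀ bd : Bond d (towerP L m (n + 1)), ‖((fun _ : Bond d (towerP L m (n + 1)) => (1 : 𝔸ˣ)) bd : 𝔸) - 1‖ ≤ 0 * η := fun _ => by simp
  have hpl1 : ∀ p : B9SectCLatticeCarrier.Plaq d (towerP L m (n + 1)), ‖(plaqHolU (fun _ : Bond d (towerP L m (n + 1)) => (1 : 𝔸ˣ)) p : 𝔸) - 1‖ ≤ 0 * η ^ 2 := fun _ => by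
    simp [plaqHolU_one]
  have hUgrad1 : ∀ (x : TSite d (towerP L m (n + 1))) (μ : Fin d), ‖((fun _ : Bond d (towerP L m (n + 1)) => (1 : 𝔸ˣ)) (x, μ) : 𝔸) - (fun _ : Bond d (towerP L m (n + 1)) => (1 : 𝔸ˣ)) (unshift μ x, μ)‖ ≤ 0 * η ^ 2 := fun _ _ => by simp
  have hεg1 : ∀ j < n + 1, (fun _ : ℕ => (0 : ℝ)) j ≤ 0 * (1 / 2 : ℝ) ^ j := fun _ _ => by simp
  have hAQ1 : ∑ j ∈ Finset.range (n + 1), (fun _ : ℕ => (0 : ℝ)) j ≤ 0 := by simp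
  -- (3) the two rows at the vacuum
  have hval : ∀ b' : Bond d (towerP L m (n + 1)), ‖A b'‖ ≤ B * Real.exp (-(δ * tdist m (πB (bpos b')) v)) * F := fun b' =>
    ROW n η hηL c₀ c₁ hw hρ m hm (fun _ : Bond d (towerP L m (n + 1)) => (1 : 𝔸ˣ)) (fun _ => 0) (fun _ => le_rfl) (fun _ => by norm_num) (perCfg_UlevOf_one_mem_U1 L m (n + 1))
      (norm_Wcx_UlevOf_one_sub_one_le L m (n + 1) (fun _ => 0) (fun _ => le_rfl)) (fun _ => 0) (fun _ => le_rfl) hUε1 hLb1 0 le_rfl hα₁.le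
      hUst1 hUb1 hUη1 hpl1 hUgrad1 hRlev1 hεg1 hAQ1 hpos'₁ hpos₁ v f F hfv hfF b'
  have hgrad : ∀ (b' : Bond d (towerP L m (n + 1))) (μ : Fin d),
      ‖covGrad ((η : ℂ))⁻¹ (fun _ : Bond d (towerP L m (n + 1)) => (LinearMap.id : W →ₗ[ℂ] W)) A (b', μ)‖ ≤
        B' * Real.exp (-(δ' * tdist m (πB (btgt b')) v)) * F := fun b' μ => by
    have h := (GROW n η hηL c₀ c₁ hw hρ m hm (fun _ : Bond d (towerP L m (n + 1)) => (1 : 𝔸ˣ)) (fun _ => 0) (fun _ => le_rfl) (fun _ => by norm_num) (perCfg_UlevOf_one_mem_U1 L m (n + 1))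
      (norm_Wcx_UlevOf_one_sub_one_le L m (n + 1) (fun _ => 0) (fun _ => le_rfl)) (fun _ => 0) (fun _ => le_rfl) hUε1 hLb1 0 le_rfl hα₂.le
      hUst1 hUb1 hUη1 hpl1 hUgrad1 hRlev1 hεg1 hAQ1 hpos'₁ hpos₁ v f F hfv hfF μ b').2
    rwa [adTransportW_one_fun φ] at h
  -- (4) geometry: one unit step moves the block coordinate by at most 1
  have hstep : ∀ (x : TSite d (towerP L m (n + 1))) (μ : Fin d), tdist m (πB x) (πB (shift μ x)) ≤ 1 := fun x μ =>
    tdist_bigBlock_bpos_btgt_le_one (L := L) (m := m) (k := n + 1) hm (x, μ)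
  have hπs : ∀ (μ : Fin d) (x : TSite d (towerP L m (n + 1))), tdist m (πB x) v ≤ tdist m (πB (shift μ x)) v + 1 := fun μ x => by
    have h := tdist_triangle hm (πB x) (πB (shift μ x)) v
    linarith [hstep x μ]
  have hπu : ∀ (μ : Fin d) (x : TSite d (towerP L m (n + 1))), tdist m (πB x) v ≤ tdist m (πB (unshift μ x)) v + 1 := fun μ x => by
    have h1 := hstep (unshift μ x) μ
    rw [shift_unshift, tdist_symm hm] at h1
    have h := tdist_triangle hm (πB x) (πB (unshift μ x)) v
    linarith
  -- (5) both rows at the common rate `κ`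
  have hweak : ∀ {r : ℝ} (t : ℝ), κ ≤ r → 0 ≤ t → Real.exp (-(r * t)) ≤ Real.exp (-(κ * t)) := fun t hr ht =>
    Real.exp_le_exp.mpr (by nlinarith)
  have hvalκ : ∀ (x : TSite d (towerP L m (n + 1))) (μ : Fin d), ‖A (x, μ)‖ ≤ B * Real.exp (-(κ * tdist m (πB x) v)) * F := fun x μ =>
    (hval (x, μ)).trans (mul_le_mul_of_nonneg_right (mul_le_mul_of_nonneg_left (hweak _ hκδ (tdist_nonneg _ _ _)) hB) hF)
  have hgradκ : ∀ (x : TSite d (towerP L m (n + 1))) (μ : Fin d),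
      ‖covGrad ((η : ℂ))⁻¹ (fun _ : Bond d (towerP L m (n + 1)) => (LinearMap.id : W →ₗ[ℂ] W)) A ((x, μ), μ)‖ ≤ B' * Real.exp (-(κ * tdist m (πB (shift μ x)) v)) * F :=
    fun x μ => (hgrad (x, μ) μ).trans (mul_le_mul_of_nonneg_right (mul_le_mul_of_nonneg_left (hweak _ hκδ' (tdist_nonneg _ _ _)) hB') hF)
  -- (6) the unit-step bookkeeping at `y`: every bond `(y − e_μ, μ)` has its base one step from `y` and its tip AT `y`
  set E : ℝ := Real.exp (-(κ * tdist m (πB y) v)) with hE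
  have hA1 : ∀ μ : Fin d, ‖A (unshift μ y, μ)‖ ≤ B * (Real.exp κ * E) * F := fun μ => by
    refine (hvalκ _ _).trans (mul_le_mul_of_nonneg_right (mul_le_mul_of_nonneg_left ?_ hB) hF)
    have h := exp_step_le (κ := κ) (ρ := 1) hκ0.le (hπu μ y)
    rwa [mul_one] at h
  have hD1 : ∀ μ : Fin d, ‖covGrad ((η : ℂ))⁻¹ (fun _ : Bond d (towerP L m (n + 1)) => (LinearMap.id : W →ₗ[ℂ] W)) A ((unshift μ y, μ), μ)‖ ≤ B' * E * F := fun μ => by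
    have h := hgradκ (unshift μ y) μ
    rwa [shift_unshift] at h
  -- (7) the transporter letter `‖S(b)w − w‖ ≤ 2M_φM_φ′αη‖w‖`, `‖c‖ = η⁻¹`
  have hUb1 : ∀ bd : Bond d (towerP L m (n + 1)), (fun _ : Bond d (towerP L m (n + 1)) => (1 : 𝔸ˣ)) bd ∈ U1 𝔸 := fun _ => one_mem _
  have hSε : ∀ (bd : Bond d (towerP L m (n + 1))) (w : W), ‖adTransportW φ (fun bd => (U bd)⁻¹) bd w - w‖ ≤ 2 * Mφ * Mφ' * (α * η) * ‖w‖ := fun bd w => by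
    have h := norm_adTransportW_inv_sub_adTransportW_inv_le φ hφ hφ' hMφ' U (fun _ : Bond d (towerP L m (n + 1)) => (1 : 𝔸ˣ)) bd bd (hUb bd) (hUb1 bd) w
    rw [inv_one_fun, B5Eq172HodgePositivity.adTransportW_one, LinearMap.id_apply, Units.val_one] at h
    exact h.trans (by gcongr; exact hUη bd)
  have hcn : ‖((η : ℂ))⁻¹‖ = η⁻¹ := by rw [norm_inv, Complex.norm_real, Real.norm_eq_abs, abs_of_pos hη]
  have hηne : η ≠ 0 := hη.ne'
  -- (8) THE FLAT DIVERGENCE `D*_1A(y) = −Σ_μ ∇_1A((y−e_μ,μ),μ)` and THE DIFFERENCE `(D*_S − D*_1)A(y) = c•Σ_μ(S − 1)A(y−e_μ,μ)`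
  have hflat : ‖covDiv ((η : ℂ))⁻¹ (fun _ : Bond d (towerP L m (n + 1)) => (LinearMap.id : W →ₗ[ℂ] W)) A y‖ ≤ (d : ℝ) * (B' * E * F) := by
    rw [covDiv_flat_eq_neg_sum_covGrad, norm_neg]
    refine (norm_sum_le _ _).trans ((Finset.sum_le_sum fun μ _ => hD1 μ).trans (le_of_eq ?_))
    simp only [Finset.sum_const, Finset.card_univ, Fintype.card_fin, nsmul_eq_mul]
  have hdiff : ‖covDiv ((η : ℂ))⁻¹ (adTransportW φ fun bd => (U bd)⁻¹) A y -
      covDiv ((η : ℂ))⁻¹ (fun _ : Bond d (towerP L m (n + 1)) => (LinearMap.id : W →ₗ[ℂ] W)) A y‖ ≤ (d : ℝ) * (2 * Mφ * Mφ' * α * (B * (Real.exp κ * E) * F)) := by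
    rw [covDiv_sub_flat_apply, norm_smul, hcn]
    have h1 : ‖∑ μ, (adTransportW φ (fun bd => (U bd)⁻¹) (unshift μ y, μ) (A (unshift μ y, μ)) - A (unshift μ y, μ))‖ ≤
        ∑ _μ : Fin d, 2 * Mφ * Mφ' * (α * η) * (B * (Real.exp κ * E) * F) :=
      (norm_sum_le _ _).trans (Finset.sum_le_sum fun μ _ => (hSε _ _).trans (mul_le_mul_of_nonneg_left (hA1 μ) (by positivity)))
    refine (mul_le_mul_of_nonneg_left h1 (inv_nonneg.mpr hη.le)).trans (le_of_eq ?_)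
    simp only [Finset.sum_const, Finset.card_univ, Fintype.card_fin, nsmul_eq_mul]
    field_simp
  -- (9) read through `WL2.equiv` and conclude
  have hflat' : covDivL2K ℂ c₀ ((η : ℂ))⁻¹ (adTransportW φ fun bd => ((fun _ : Bond d (towerP L m (n + 1)) => (1 : 𝔸ˣ)) bd)⁻¹) g =
      covDivL2K ℂ c₀ ((η : ℂ))⁻¹ (fun _ : Bond d (towerP L m (n + 1)) => (LinearMap.id : W →ₗ[ℂ] W)) g := by
    rw [inv_one_fun, adTransportW_one_fun φ]
  refine ⟨?_, ?_⟩
  · rw [equiv_covDivL2K]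
    have hsplit : covDiv ((η : ℂ))⁻¹ (adTransportW φ fun bd => (U bd)⁻¹) A y =
        (covDiv ((η : ℂ))⁻¹ (adTransportW φ fun bd => (U bd)⁻¹) A y - covDiv ((η : ℂ))⁻¹ (fun _ : Bond d (towerP L m (n + 1)) => (LinearMap.id : W →ₗ[ℂ] W)) A y) +
          covDiv ((η : ℂ))⁻¹ (fun _ : Bond d (towerP L m (n + 1)) => (LinearMap.id : W →ₗ[ℂ] W)) A y := (sub_add_cancel _ _).symm
    rw [hsplit]
    refine (norm_add_le _ _).trans ((add_le_add hdiff hflat).trans ?_)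
    have hE0 : 0 ≤ E := Real.exp_nonneg _
    have hexp1 : (1 : ℝ) ≤ Real.exp κ := Real.one_le_exp hκ0.le
    have h1 : (d : ℝ) * (B' * E * F) ≤ (d : ℝ) * (B' * (Real.exp κ * E) * F) := by
      have : B' * E * F ≤ B' * (Real.exp κ * E) * F := by nlinarith [mul_nonneg hB' (mul_nonneg hE0 hF)]
      exact mul_le_mul_of_nonneg_left this (Nat.cast_nonneg d)
    have h2 : (d : ℝ) * (2 * Mφ * Mφ' * α * (B * (Real.exp κ * E) * F)) ≤ (d : ℝ) * (2 * Mφ * Mφ' * 1 * (B * (Real.exp κ * E) * F)) := by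
      gcongr
    calc (d : ℝ) * (2 * Mφ * Mφ' * α * (B * (Real.exp κ * E) * F)) + (d : ℝ) * (B' * E * F)
        ≤ (d : ℝ) * (2 * Mφ * Mφ' * 1 * (B * (Real.exp κ * E) * F)) + (d : ℝ) * (B' * (Real.exp κ * E) * F) := add_le_add h2 h1
      _ = Cp * E * F := by rw [hCp]; ring
  · rw [hflat', equiv_covDivL2K, equiv_covDivL2K]
    refine hdiff.trans ?_
    rw [hCp]
    have hE0 : 0 ≤ E := Real.exp_nonneg _
    have hx : 0 ≤ (d : ℝ) * B' * Real.exp κ * α * E * F := by positivity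
    calc (d : ℝ) * (2 * Mφ * Mφ' * α * (B * (Real.exp κ * E) * F))
        = (d : ℝ) * (2 * Mφ * Mφ' * B) * Real.exp κ * α * E * F := by ring
      _ ≤ (d : ℝ) * (2 * Mφ * Mφ' * B) * Real.exp κ * α * E * F + (d : ℝ) * B' * Real.exp κ * α * E * F := le_add_of_nonneg_right hx
      _ = (d : ℝ) * (B' + 2 * Mφ * Mφ' * B) * Real.exp κ * α * E * F := by ring

end Literature.MathematicalPhysics.QuantumFieldTheory.Balaban1983to89.B9Eq375BondDivergenceTwoBackgroundLetterTower

end
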